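import Literature.Barriers.CriticalPhenomena.LaceExpansionXSpaceMarkedSurgery
import HarnessLib

/-!
# Hara's Step 2 on the chains: every marked chain of the diagram of `Π^{(N)}` at `p_c` is at most
# `C(b,c) · (2Δ̃_{p_c}Δ_{p_c})^{N-5}` — PROVED

Barrier catalogue `Literature/Barriers/CriticalPhenomena/` (D-0021). Ninth layer under
`Hara2008_weightedNLoopBoundPc` (`LaceExpansionXSpaceLemma16.lean`): the three-factor estimate
(`LaceExpansionXSpaceKernelNorms.lean`) applied to the chain over the master kernels with two exponents set
(`LaceExpansionXSpaceMarkedSurgery.lean`), SPLIT AT THE `b`-MARK ("peel off (open) triangles from left and right,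
leaving `|x|^β`-, `|x|^γ`-weighted parts in the middle"): the units on the left propagate `ℓ¹` with their
`ℓ^∞ → ℓ^∞` norms (`lnorm`, (7.5.11)), the kernel(s) carrying the `b`-mark sit in the mixed norm, the units on the
right close the diagram with their `ℓ¹ → ℓ¹` norms (`RListK`, `rnormK`, the reversed recursion, Exercise 7.5).
Four positions of the `b`-mark: the start propagator (`chain_le_split_start`), a `B₁` (`chain_le_split_B1`), a `B₂`
(`chain_le_split_B2`, middle factor `B̃₁B̃₂B̃₁` with the two terms of `B₂`: `pkNormMix_kB1w_kB2W_kB1w_le` — the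
crossed propagator between rungs gives `W̄`, the `B₂⁽²⁾`-term goes through `T̄^{(0,b)}` with the preceding `B̃₁` in
the mixed norm), the end propagator (`chain_le_split_end`). The piece norms are then bounded by the finitely many
patterns of exponents (`exv`, `pats`, `patsC`; constants `KB = 2Δ̃Δ`, `rungB`, `b2B`, `mixB`, the sums `Ssum`,
`Usum`, `Rsum`, `Msum`, `Wsum`, `Tsum`, and `Cbig`), free units contributing `K = 2Δ̃_{p_c}Δ_{p_c}` each
(`lnorm_exv_le`, `rnormK_exv_le`: at most the unit of the `c`-mark is not free on either side), whence
`chain_exv_le : chain ≤ Cbig b c · K^{n-4}` (`K ≤ 1`; at least `n - 4 = N - 5` free units: "So there are at least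
`(N-2)` open triangles" in Hara's count for his diagrams).

Scope note (see `LaceExpansionXSpaceWeightedNLoop.lean`): the `B₂⁽²⁾`-term with the `b`-mark on its path line is
bounded through `T̄^{(0,b)}`, not through Hara's `H̄^{(b)}` (`LaceExpansionXSpaceHPiece.lean`), because the printed
case (b-7) does not cover the configuration in which the `c`-mark sits on the pivotal line entering that unit.

## References

* T. Hara, Ann. Probab. 36 (2008) 530–593 (arXiv:math-ph/0504021): §3.4 (Steps 2–3, cases (b-2), (b-3), (b-7)).
* M. Heydenreich, R. van der Hofstad, *Progress in High-Dimensional Percolation and Random Graphs*,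
  Springer 2017: (7.5.9)–(7.5.12), (7.5.18)–(7.5.21), (7.5.26)–(7.5.29), Exercise 7.5.
-/

noncomputable section

namespace Literature.Barriers.CriticalPhenomena

open _root_.MeasureTheory _root_.Filter Literature.Probability.LatticeModels
  Literature.Probability.Percolation

open scoped ENNReal

/-! ### Norm bounds for the left units, the right units, and the three-factor splits at the `β`-kernel -/

section ChainBounds

variable {d : ℕ}

/-- `‖X + Y‖_mix ≤ ‖X‖_mix + ‖Y‖_mix`. [folklore] -/
theorem pkNormMix_add_le (X Y : Site d × Site d → Site d × Site d → ℝ≥0∞) :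
    pkNormMix (fun p q => X p q + Y p q) ≤ pkNormMix X + pkNormMix Y := by
  refine iSup_le fun q => ?_
  rw [ENNReal.tsum_add]
  exact add_le_add (tsum_le_pkNormMix X _ _ _) (tsum_le_pkNormMix Y _ _ _)

/-- The product of the `ℓ^∞ → ℓ^∞` norms of the units `i₀+1, …, i₀+k` (blocks `B̃₁B̃₂`).
[cite: HeydenreichVanDerHofstad2017, (7.5.9)–(7.5.12)] -/
def lnorm (d : ℕ) (ex : ℕ → ℝ × ℝ) (i₀ : ℕ) : ℕ → ℝ≥0∞
  | 0 => 1
  | k + 1 => pkNormInf (pkMul (kB1w d (ex (2 * (i₀ + 1) - 1)).1 (ex (2 * (i₀ + 1) - 1)).2)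
      (kB2W d (ex (2 * (i₀ + 1))).1 (ex (2 * (i₀ + 1))).2)) * lnorm d ex (i₀ + 1) k

/-- **The left units propagate `ℓ¹` with their `ℓ^∞ → ℓ^∞` norms**:
`Σ_p (w · units_{i₀+1..i₀+k})(p) ≤ (Σ_p w(p)) Π_v ‖B̃₁^{(v)} B̃₂^{(v)}‖_{∞→∞}`. [cite: HeydenreichVanDerHofstad2017, (7.5.11)] -/
theorem tsum_pkChainL_blocksKs_le (ex : ℕ → ℝ × ℝ) (k : ℕ) : ∀ (i₀ : ℕ) (w : Site d × Site d → ℝ≥0∞),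
    ∑' p, pkChainL w (blocksKs d ex i₀ k) p ≤ (∑' p, w p) * lnorm d ex i₀ k := by
  induction k with
  | zero => intro i₀ w; simp [blocksKs, lnorm]
  | succ k ih =>
    intro i₀ w
    rw [blocksKs, lnorm, List.cons_append, List.singleton_append, pkChainL_cons_cons, pkChainL_cons]
    refine (ih (i₀ + 1) _).trans ?_
    rw [← mul_assoc]
    exact mul_le_mul' (tsum_pkVmul_le _ _) le_rfl

/-- The kernels from the `B₂` of unit `u` to the end, as `k` reversed blocks `B̃₂^{(v)} B̃₁^{(v+1)}`
(`v = u, …, u+k-1`) followed by the end kernel (index `2(u+k)`): the right factor after a middle factor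
ending at the `B₁` of unit `u` (`k = N - u` with `N = n+1`). [cite: HeydenreichVanDerHofstad2017, (7.5.18)–(7.5.20)] -/
def RListK (d : ℕ) (ex : ℕ → ℝ × ℝ) : ℕ → ℕ → List (Site d × Site d → Site d × Site d → ℝ≥0∞)
  | u, 0 => [kEndW d (ex (2 * u)).1 (ex (2 * u)).2]
  | u, k + 1 => kB2W d (ex (2 * u)).1 (ex (2 * u)).2 :: kB1w d (ex (2 * u + 1)).1 (ex (2 * u + 1)).2 ::
      RListK d ex (u + 1) k

/-- The product of the `ℓ¹ → ℓ¹` norms of the reversed blocks of `RListK`, times `‖ρ P_end‖_{1→1}`.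
[cite: HeydenreichVanDerHofstad2017, Exercise 7.5] -/
def rnormK (d : ℕ) (ex : ℕ → ℝ × ℝ) : ℕ → ℕ → ℝ≥0∞
  | u, 0 => pkNormOne (kEndW d (ex (2 * u)).1 (ex (2 * u)).2)
  | u, k + 1 => pkNormOne (pkMul (kB2W d (ex (2 * u)).1 (ex (2 * u)).2)
      (kB1w d (ex (2 * u + 1)).1 (ex (2 * u + 1)).2)) * rnormK d ex (u + 1) k

/-- All kernels of `RListK` are translation invariant. [folklore] -/
theorem pkTI_of_mem_RListK (ex : ℕ → ℝ × ℝ) (k : ℕ) : ∀ (u : ℕ), ∀ X ∈ RListK d ex u k, PkTI X := by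
  induction k with
  | zero =>
    intro u X hX
    simp only [RListK, List.mem_singleton] at hX
    rw [hX]; exact pkTI_kEndW _ _
  | succ k ih =>
    intro u X hX
    simp only [RListK, List.mem_cons] at hX
    rcases hX with rfl | rfl | hX
    · exact pkTI_kB2W _ _
    · exact pkTI_kB1w _ _
    · exact ih (u + 1) X hX

/-- **The right units close the diagram with their `ℓ¹ → ℓ¹` norms** (the reversed recursion):
`Σ_a (RListK · δ_diag)(0, a) ≤ rnormK`. [cite: HeydenreichVanDerHofstad2017, Exercise 7.5] -/
theorem tsum_pkChainR_RListK_le (ex : ℕ → ℝ × ℝ) (k : ℕ) : ∀ u : ℕ,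
    ∑' a, pkChainR (RListK d ex u k) (eDiag d) (0, a) ≤ rnormK d ex u k := by
  induction k with
  | zero =>
    intro u
    rw [RListK, rnormK, pkChainR_cons, pkChainR_nil]
    refine (tsum_pkKvec_zero_le (pkTI_kEndW _ _) pvTI_eDiag).trans ?_
    rw [tsum_eDiag_zero, mul_one]
  | succ k ih =>
    intro u
    rw [RListK, rnormK, pkChainR_cons_cons, pkChainR_cons]
    refine (tsum_pkKvec_zero_le (pkTI_pkMul (pkTI_kB2W _ _) (pkTI_kB1w _ _))
      (pvTI_pkChainR (pkTI_of_mem_RListK ex k (u + 1)) pvTI_eDiag)).trans ?_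
    exact mul_le_mul' le_rfl (ih (u + 1))

/-- Splitting the units. [folklore] -/
theorem blocksKs_add (ex : ℕ → ℝ × ℝ) (a k : ℕ) : ∀ i₀,
    blocksKs d ex i₀ (a + k) = blocksKs d ex i₀ a ++ blocksKs d ex (i₀ + a) k := by
  induction a with
  | zero => intro i₀; simp [blocksKs]
  | succ a ih =>
    intro i₀
    rw [show a + 1 + k = (a + k) + 1 by ring, blocksKs, blocksKs, ih (i₀ + 1), List.append_assoc,
      show i₀ + 1 + a = i₀ + (a + 1) by ring]

/-- The units `i₀+1, …, i₀+k` followed by the last `B₁` and the end kernel are the `B₁` of unit `i₀+1`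
followed by `RListK (i₀+1) k`. [folklore] -/
theorem blocksKs_append_final_end (ex : ℕ → ℝ × ℝ) (k : ℕ) : ∀ i₀ : ℕ,
    blocksKs d ex i₀ k ++ [kB1w d (ex (2 * (i₀ + k) + 1)).1 (ex (2 * (i₀ + k) + 1)).2,
      kEndW d (ex (2 * (i₀ + k) + 2)).1 (ex (2 * (i₀ + k) + 2)).2] =
      kB1w d (ex (2 * i₀ + 1)).1 (ex (2 * i₀ + 1)).2 :: RListK d ex (i₀ + 1) k := by
  induction k with
  | zero =>
    intro i₀
    rw [blocksKs, List.nil_append, RListK, show 2 * (i₀ + 0) + 1 = 2 * i₀ + 1 by ring,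
      show 2 * (i₀ + 0) + 2 = 2 * (i₀ + 1) by ring]
  | succ k ih =>
    intro i₀
    rw [blocksKs, List.append_assoc, show 2 * (i₀ + (k + 1)) = 2 * (i₀ + 1 + k) by ring, ih (i₀ + 1), RListK,
      show 2 * (i₀ + 1) - 1 = 2 * i₀ + 1 by omega, show i₀ + 1 + 1 = i₀ + 2 by ring]
    rfl

/-- **The master kernels split at the `B₁` of unit `u`** (`1 ≤ u ≤ n+1`): left units `1..u-1`, the kernel
`B̃₁^{(u)}`, and `RListK u (n+1-u)`. [folklore] -/
theorem mKsE_split_B1 (n : ℕ) (ex : ℕ → ℝ × ℝ) {u : ℕ} (hu1 : 1 ≤ u) (hun : u ≤ n + 1) :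
    mKsE d n ex = kStartW d (ex 0).1 (ex 0).2 :: (blocksKs d ex 0 (u - 1) ++
      kB1w d (ex (2 * u - 1)).1 (ex (2 * u - 1)).2 :: RListK d ex u (n + 1 - u)) := by
  rw [mKsE, show n = (u - 1) + (n + 1 - u) by omega, blocksKs_add, List.append_assoc, zero_add,
    show 2 * (u - 1 + (n + 1 - u)) + 1 = 2 * ((u - 1) + (n + 1 - u)) + 1 from rfl,
    blocksKs_append_final_end ex (n + 1 - u) (u - 1),
    show 2 * (u - 1) + 1 = 2 * u - 1 by omega, show u - 1 + 1 = u by omega,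
    show u - 1 + (n + 1 - u) = n by omega]

end ChainBounds

/-! ### The four splits of a marked chain at the position of the `β`-mark -/

section Splits

variable {d : ℕ}

/-- The start row: `Σ_q (δ₀ S)(q) ≤ ‖S‖_{∞→∞}`. [folklore] -/
theorem tsum_pkVmul_vDelta_le (S : Site d × Site d → Site d × Site d → ℝ≥0∞) :
    ∑' q, pkVmul (vDelta d) S q ≤ pkNormInf S := by
  refine le_trans (le_of_eq (tsum_congr fun q => pkVmul_vDelta S q)) (tsum_le_pkNormInf S _)

/-- **Split at the `B₁` of unit `u`** (`1 ≤ u ≤ N = n+1`; the three-factor estimate with the single kernel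
`B̃₁^{(u)}` in the mixed norm): `chain ≤ ‖S‖_{∞→∞} Π_{v<u}‖B̃₁B̃₂‖_{∞→∞} · ‖B̃₁^{(u)}‖_mix · rnormK`.
[cite: Hara2008, §3.4 (Step 2, cases (b-2), (b-3))] [cite: HeydenreichVanDerHofstad2017, (7.5.18)–(7.5.21)] -/
theorem chain_le_split_B1 (n : ℕ) (ex : ℕ → ℝ × ℝ) {u : ℕ} (hu1 : 1 ≤ u) (hun : u ≤ n + 1) :
    ∑' p, pkChainL (vDelta d) (mKsE d n ex) p * eDiag d p ≤
      pkNormInf (kStartW d (ex 0).1 (ex 0).2) * lnorm d ex 0 (u - 1) *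
        pkNormMix (kB1w d (ex (2 * u - 1)).1 (ex (2 * u - 1)).2) * rnormK d ex u (n + 1 - u) := by
  rw [mKsE_split_B1 n ex hu1 hun, pkChainL_cons, ← List.nil_append (RListK d ex u (n + 1 - u))]
  refine (tsum_pkChainL_three_factor _ _ [] _ _ _ (pkTI_of_mem_RListK ex _ u) pvTI_eDiag).trans ?_
  rw [pkProd_nil]
  refine mul_le_mul' (mul_le_mul' ?_ le_rfl) (tsum_pkChainR_RListK_le ex _ u)
  exact (tsum_pkChainL_blocksKs_le ex _ 0 _).trans (mul_le_mul' (tsum_pkVmul_vDelta_le _) le_rfl)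

/-- **Split at the start kernel** (its free propagator `P_{G^{(b)},G^{(c)}}` in the mixed norm, its rung moved
onto the first `B₁`): `chain ≤ ‖P‖_mix · ‖ρB̃₁^{(1)}‖_{1→1} · rnormK`. [cite: Hara2008, §3.4 (Step 2)] -/
theorem chain_le_split_start (n : ℕ) (ex : ℕ → ℝ × ℝ) :
    ∑' p, pkChainL (vDelta d) (mKsE d n ex) p * eDiag d p ≤
      pkNormMix (kProp (gE d (ex 0).1) (gE d (ex 0).2)) *
        (pkNormOne (kRungL (kB1w d (ex 1).1 (ex 1).2)) * rnormK d ex 1 n) := by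
  have hlist : mKsE d n ex = kStartW d (ex 0).1 (ex 0).2 :: kB1w d (ex 1).1 (ex 1).2 :: RListK d ex 1 n := by
    rw [mKsE]
    have h := blocksKs_append_final_end (d := d) ex n 0
    simp only [zero_add, mul_zero] at h
    rw [h]
  rw [hlist, pkChainL_cons_cons, kStartW, pkMul_kRungR, ← pkChainL_cons_cons,
    show kProp (gE d (ex 0).1) (gE d (ex 0).2) :: kRungL (kB1w d (ex 1).1 (ex 1).2) :: RListK d ex 1 n =
      [] ++ kProp (gE d (ex 0).1) (gE d (ex 0).2) :: ([] ++ (kRungL (kB1w d (ex 1).1 (ex 1).2) :: RListK d ex 1 n))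
      from rfl]
  have hTI : ∀ X ∈ kRungL (kB1w d (ex 1).1 (ex 1).2) :: RListK d ex 1 n, PkTI X := by
    intro X hX
    simp only [List.mem_cons] at hX
    rcases hX with rfl | hX
    · exact pkTI_kRungL (pkTI_kB1w _ _)
    · exact pkTI_of_mem_RListK ex n 1 X hX
  refine (tsum_pkChainL_three_factor _ [] [] _ _ _ hTI pvTI_eDiag).trans ?_
  rw [pkChainL_nil, tsum_vDelta, one_mul, pkProd_nil, pkChainR_cons]
  refine mul_le_mul' le_rfl ?_
  exact (tsum_pkKvec_zero_le (pkTI_kRungL (pkTI_kB1w _ _)) (pvTI_pkChainR (pkTI_of_mem_RListK ex n 1)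
    pvTI_eDiag)).trans (mul_le_mul' le_rfl (tsum_pkChainR_RListK_le ex n 1))

/-- **Split at the end kernel** (all units on the left, then `B̃₁^{(N)}ρ` in `‖·‖_{∞→∞}` and the free end
propagator in the mixed norm): `chain ≤ ‖S‖ Π_v‖B̃₁B̃₂‖ · ‖B̃₁^{(N)}ρ‖_{∞→∞} ‖P_end‖_mix`. [cite: Hara2008, §3.4 (Step 2)] -/
theorem chain_le_split_end (n : ℕ) (ex : ℕ → ℝ × ℝ) :
    ∑' p, pkChainL (vDelta d) (mKsE d n ex) p * eDiag d p ≤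
      pkNormInf (kStartW d (ex 0).1 (ex 0).2) * lnorm d ex 0 n *
        (pkNormInf (kRungR (kB1w d (ex (2 * n + 1)).1 (ex (2 * n + 1)).2)) *
          pkNormMix (kProp (gE d (ex (2 * n + 2)).1) (gE d (ex (2 * n + 2)).2))) := by
  rw [mKsE, pkChainL_cons, pkChainL_append, kEndW, pkChainL_cons_cons, ← pkMul_kRungR, ← pkChainL_cons_cons,
    ← pkChainL_append,
    show blocksKs d ex 0 n ++ [kRungR (kB1w d (ex (2 * n + 1)).1 (ex (2 * n + 1)).2),
        kProp (gE d (ex (2 * n + 2)).1) (gE d (ex (2 * n + 2)).2)] =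
      blocksKs d ex 0 n ++ kRungR (kB1w d (ex (2 * n + 1)).1 (ex (2 * n + 1)).2) ::
        ([kProp (gE d (ex (2 * n + 2)).1) (gE d (ex (2 * n + 2)).2)] ++ []) from rfl]
  refine (tsum_pkChainL_three_factor _ _ _ [] _ _ (fun X hX => by simp at hX) pvTI_eDiag).trans ?_
  rw [pkChainR_nil, tsum_eDiag_zero, mul_one, pkProd_cons, pkProd_nil]
  refine mul_le_mul' ?_ (pkNormMix_pkMul_le _ _)
  exact (tsum_pkChainL_blocksKs_le ex _ 0 _).trans (mul_le_mul' (tsum_pkVmul_vDelta_le _) le_rfl)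

/-- **The middle factor `B̃₁^{(u)} B̃₂^{(u)} B̃₁^{(u+1)}` in the mixed norm** (the two terms of `B₂`: the
crossed propagator between rungs — `W̄` of its two lines — and the `B₂⁽²⁾`-term through `T̄^{(0,b)}` with the
preceding `B̃₁` in the mixed norm):
`‖B̃₁' B̃₂^{(b,c)} B̃₁''‖_mix ≤ ‖B̃₁'ρ‖_{∞→∞} W̄^{(b,c)} ‖ρB̃₁''‖_{1→1} + ‖B̃₁'‖_mix |0|^c T̄^{(0,b)} ‖ρB̃₁''‖_{1→1}`.
[cite: Hara2008, §3.4 (Step 2)] [cite: HeydenreichVanDerHofstad2017, (7.5.26)–(7.5.29)] -/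
theorem pkNormMix_kB1w_kB2W_kB1w_le (e' e e'' : ℝ × ℝ) :
    pkNormMix (pkMul (kB1w d e'.1 e'.2) (pkMul (kB2W d e.1 e.2) (kB1w d e''.1 e''.2))) ≤
      pkNormInf (kRungR (kB1w d e'.1 e'.2)) * haraWBar d e.1 e.2 * pkNormOne (kRungL (kB1w d e''.1 e''.2)) +
        pkNormMix (kB1w d e'.1 e'.2) * (wE e.2 (0 : Site d) * haraTBar d 0 e.1 *
          pkNormOne (kRungL (kB1w d e''.1 e''.2))) := by
  rw [show kB2W d e.1 e.2 = fun p q => kB2oneW d e.1 e.2 p q + kB2twoW d e.1 e.2 p q from rfl,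
    pkMul_add_left, pkMul_add_right]
  refine (pkNormMix_add_le _ _).trans (add_le_add ?_ ?_)
  · exact pkNormMix_mid_kB2oneW_le _ _ (pkTI_kB1w _ _) e.1 e.2
  · refine (pkNormMix_pkMul_le' _ _ (pkTI_pkMul (pkTI_kB2twoW _ _) (pkTI_kB1w _ _))).trans ?_
    exact mul_le_mul' le_rfl (pkNormOne_kB2twoW_kProp_le _ _ e.1 e.2)

/-- **Split at the `B₂` of unit `u`** (`1 ≤ u ≤ n`; middle factor `B̃₁^{(u)} B̃₂^{(u)} B̃₁^{(u+1)}`).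
[cite: Hara2008, §3.4 (Step 2)] [cite: HeydenreichVanDerHofstad2017, (7.5.26)–(7.5.27)] -/
theorem chain_le_split_B2 (n : ℕ) (ex : ℕ → ℝ × ℝ) {u : ℕ} (hu1 : 1 ≤ u) (hun : u ≤ n) :
    ∑' p, pkChainL (vDelta d) (mKsE d n ex) p * eDiag d p ≤
      pkNormInf (kStartW d (ex 0).1 (ex 0).2) * lnorm d ex 0 (u - 1) *
        (pkNormInf (kRungR (kB1w d (ex (2 * u - 1)).1 (ex (2 * u - 1)).2)) * haraWBar d (ex (2 * u)).1 (ex (2 * u)).2 *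
            pkNormOne (kRungL (kB1w d (ex (2 * u + 1)).1 (ex (2 * u + 1)).2)) +
          pkNormMix (kB1w d (ex (2 * u - 1)).1 (ex (2 * u - 1)).2) * (wE (ex (2 * u)).2 (0 : Site d) *
            haraTBar d 0 (ex (2 * u)).1 * pkNormOne (kRungL (kB1w d (ex (2 * u + 1)).1 (ex (2 * u + 1)).2)))) *
        rnormK d ex (u + 1) (n - u) := by
  rw [mKsE_split_B1 n ex hu1 (by omega), pkChainL_cons, show n + 1 - u = (n - u) + 1 by omega, RListK,
    show kB1w d (ex (2 * u - 1)).1 (ex (2 * u - 1)).2 :: kB2W d (ex (2 * u)).1 (ex (2 * u)).2 ::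
        kB1w d (ex (2 * u + 1)).1 (ex (2 * u + 1)).2 :: RListK d ex (u + 1) (n - u) =
      kB1w d (ex (2 * u - 1)).1 (ex (2 * u - 1)).2 :: ([kB2W d (ex (2 * u)).1 (ex (2 * u)).2,
        kB1w d (ex (2 * u + 1)).1 (ex (2 * u + 1)).2] ++ RListK d ex (u + 1) (n - u)) from rfl]
  refine (tsum_pkChainL_three_factor _ _ _ _ _ _ (pkTI_of_mem_RListK ex _ (u + 1)) pvTI_eDiag).trans ?_
  refine mul_le_mul' (mul_le_mul' ?_ ?_) (tsum_pkChainR_RListK_le ex _ (u + 1))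
  · exact (tsum_pkChainL_blocksKs_le ex _ 0 _).trans (mul_le_mul' (tsum_pkVmul_vDelta_le _) le_rfl)
  · rw [pkProd_cons, pkProd_cons, pkProd_nil]
    exact pkNormMix_kB1w_kB2W_kB1w_le _ _ _

end Splits

/-! ### The exponents of a doubly marked chain and the finitely many patterns -/

section Patterns

variable {d : ℕ}

/-- The exponents of the chain with the `b`-mark at `j` (path `P₁`) and the `c`-mark at `l` (path `P₂`).
[cite: Hara2008, §3.4 (Step 1)] -/
def exv (j l : ℕ) (b c : ℝ) (k : ℕ) : ℝ × ℝ :=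
  if k = j then (if k = l then (if pol k then (b, c) else (c, b)) else (if pol k then (b, 0) else (0, b)))
  else if k = l then (if pol k then (0, c) else (c, 0)) else (0, 0)

/-- `setC (setB 0 j b) l c = exv j l b c`. [folklore] -/
theorem setC_setB_eZero (j l : ℕ) (b c : ℝ) : setC (setB eZero j b) l c = exv j l b c := by
  funext k
  unfold setC setB exv eZero
  by_cases hkj : k = j
  · subst hkj
    by_cases hkl : k = l
    · subst hkl
      rw [Function.update_self, if_pos rfl, if_pos rfl, Function.update_self]
      by_cases hp : pol k <;> simp [hp]
    · rw [Function.update_of_ne hkl, Function.update_self, if_pos rfl, if_neg hkl]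
  · rw [if_neg hkj]
    by_cases hkl : k = l
    · subst hkl
      rw [Function.update_self, Function.update_of_ne hkj, if_pos rfl]
    · rw [Function.update_of_ne hkl, Function.update_of_ne hkj, if_neg hkl]

/-- The seven exponent patterns of a chain with marks `b` (along `P₁`) and `c` (along `P₂`). [folklore] -/
def pats (b c : ℝ) : List (ℝ × ℝ) := [(0, 0), (b, 0), (0, b), (c, 0), (0, c), (b, c), (c, b)]

/-- The three patterns away from the `b`-mark. [folklore] -/
def patsC (c : ℝ) : List (ℝ × ℝ) := [(0, 0), (c, 0), (0, c)]

/-- Every exponent of a marked chain is one of the seven patterns. [folklore] -/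
theorem exv_mem_pats (j l : ℕ) (b c : ℝ) (k : ℕ) : exv j l b c k ∈ pats b c := by
  unfold exv pats
  split_ifs <;> simp

/-- Away from the `b`-mark the exponent is one of the three patterns. [folklore] -/
theorem exv_mem_patsC {j l : ℕ} (b c : ℝ) {k : ℕ} (hk : k ≠ j) : exv j l b c k ∈ patsC c := by
  unfold exv patsC
  rw [if_neg hk]
  split_ifs <;> simp

/-- The three patterns are among the seven. [folklore] -/
theorem patsC_subset_pats (b c : ℝ) {e : ℝ × ℝ} (h : e ∈ patsC c) : e ∈ pats b c := by
  simp only [patsC, pats, List.mem_cons, List.mem_nil_iff, or_false] at h ⊢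
  rcases h with h | h | h <;> simp [h]

/-- Patterns are non-negative. [folklore] -/
theorem nonneg_of_mem_pats {b c : ℝ} (hb : 0 ≤ b) (hc : 0 ≤ c) {e : ℝ × ℝ} (h : e ∈ pats b c) :
    0 ≤ e.1 ∧ 0 ≤ e.2 := by
  simp only [pats, List.mem_cons, List.mem_nil_iff, or_false] at h
  rcases h with rfl | rfl | rfl | rfl | rfl | rfl | rfl <;> exact ⟨by positivity, by positivity⟩

/-- A summand is at most the sum (lists in `[0, ∞]`). [folklore] -/
theorem le_sum_map_of_mem {α : Type*} {l : List α} {x : α} (hx : x ∈ l) (f : α → ℝ≥0∞) :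
    f x ≤ (l.map f).sum := by
  induction l with
  | nil => simp at hx
  | cons y l ih =>
    rw [List.map_cons, List.sum_cons]
    rcases List.mem_cons.1 hx with rfl | hx
    · exact le_self_add
    · exact (ih hx).trans le_add_self

/-! ### The constants -/

/-- `K = 2 Δ̃_{p_c} Δ_{p_c}`, the rate of a free unit. [cite: HeydenreichVanDerHofstad2017, (7.5.12)] -/
def KB (d : ℕ) : ℝ≥0∞ := 2 * percTriTildeBar d * percTriBar d

/-- The bound of `‖B̃₁^{(e₁)}ρ‖_{∞→∞}` and `‖ρB̃₁^{(e₁)}‖_{1→1}`. [cite: Hara2008, §3.4 (Step 2)] -/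
def rungB (d : ℕ) (e : ℝ × ℝ) : ℝ≥0∞ := pivC d e.2 * (haraTBar d e.1 e.2 + haraTBar d e.1 0)

/-- The bound of `‖P B̃₂^{(e₂)}‖ / ‖B̃₂^{(e₂)} P‖` relative to the rung norm of `P`. [cite: Hara2008, §3.4 (Step 2)] -/
def b2B (d : ℕ) (e : ℝ × ℝ) : ℝ≥0∞ := haraTBar d e.1 e.2 + wE e.2 (0 : Site d) * haraTBar d 0 e.1

/-- The bound of `‖B̃₁^{(e)}‖_mix`. [cite: Hara2008, §3.4 (Step 2, cases (b-2), (b-3))] -/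
def mixB (d : ℕ) (e : ℝ × ℝ) : ℝ≥0∞ := pivC d e.2 * (haraWBar d e.1 e.2 + haraWBar d e.1 0)

/-- Sum of the start/end bounds `T̄^{(e)}` over the patterns away from the `b`-mark. [folklore] -/
def Ssum (d : ℕ) (c : ℝ) : ℝ≥0∞ := ((patsC c).map fun e => haraTBar d e.1 e.2).sum

/-- Sum of the unit bounds over the patterns away from the `b`-mark, plus `K`. [folklore] -/
def Usum (d : ℕ) (c : ℝ) : ℝ≥0∞ :=
  KB d + ((patsC c).map fun e₁ => ((patsC c).map fun e₂ => b2B d e₂ * rungB d e₁).sum).sum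

/-- Sum of the rung bounds over the patterns away from the `b`-mark. [folklore] -/
def Rsum (d : ℕ) (c : ℝ) : ℝ≥0∞ := ((patsC c).map fun e => rungB d e).sum

/-- Sum of the mixed-norm bounds over all patterns. [folklore] -/
def Msum (d : ℕ) (b c : ℝ) : ℝ≥0∞ := ((pats b c).map fun e => mixB d e).sum

/-- Sum of `W̄^{(e)}` over all patterns. [folklore] -/
def Wsum (d : ℕ) (b c : ℝ) : ℝ≥0∞ := ((pats b c).map fun e => haraWBar d e.1 e.2).sum

/-- Sum of `|0|^{e₂} T̄^{(0,e₁)}` over all patterns. [folklore] -/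
def Tsum (d : ℕ) (b c : ℝ) : ℝ≥0∞ := ((pats b c).map fun e => wE e.2 (0 : Site d) * haraTBar d 0 e.1).sum

/-- **The constant of the marked chains** (uniform in `N` and in the positions of the marks).
[cite: Hara2008, §3.4 (Step 3: "c N^{2+β+γ}(2c'λ)^{N-2}")] -/
def Cbig (d : ℕ) (b c : ℝ) : ℝ≥0∞ :=
  (1 + Ssum d c) ^ 2 * (1 + Usum d c) ^ 2 * ((1 + Msum d b c) * (1 + Rsum d c) +
    (1 + Wsum d b c) * (1 + Rsum d c) ^ 2 + (1 + Msum d b c) * (1 + Tsum d b c) * (1 + Rsum d c))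

/-! ### The individual factors are bounded by the sums -/

/-- The start kernel is bounded by `1 + Ssum`. [folklore] -/
theorem pkNormInf_kStartW_le_Ssum {c : ℝ} {e : ℝ × ℝ} (h : e ∈ patsC c) :
    pkNormInf (kStartW d e.1 e.2) ≤ 1 + Ssum d c :=
  ((pkNormInf_kStartW_le e.1 e.2).trans (le_sum_map_of_mem h fun e => haraTBar d e.1 e.2)).trans le_add_self

/-- The end kernel is bounded by `1 + Ssum`. [folklore] -/
theorem pkNormOne_kEndW_le_Ssum {c : ℝ} {e : ℝ × ℝ} (h : e ∈ patsC c) :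
    pkNormOne (kEndW d e.1 e.2) ≤ 1 + Ssum d c :=
  ((pkNormOne_kEndW_le e.1 e.2).trans (le_sum_map_of_mem h fun e => haraTBar d e.1 e.2)).trans le_add_self

/-- `‖B̃₁ρ‖_{∞→∞} ≤ rungB`. [folklore] -/
theorem pkNormInf_kRungR_kB1w_le_rungB {e : ℝ × ℝ} (he : 0 ≤ e.2) :
    pkNormInf (kRungR (kB1w d e.1 e.2)) ≤ rungB d e := pkNormInf_kRungR_kB1w_le e.1 he

/-- `‖ρB̃₁‖_{1→1} ≤ rungB`. [folklore] -/
theorem pkNormOne_kRungL_kB1w_le_rungB {e : ℝ × ℝ} (he : 0 ≤ e.2) :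
    pkNormOne (kRungL (kB1w d e.1 e.2)) ≤ rungB d e := pkNormOne_kRungL_kB1w_le e.1 he

/-- `rungB ≤ 1 + Rsum`. [folklore] -/
theorem rungB_le_Rsum {c : ℝ} {e : ℝ × ℝ} (h : e ∈ patsC c) : rungB d e ≤ 1 + Rsum d c :=
  (le_sum_map_of_mem h (rungB d)).trans le_add_self

/-- `mixB ≤ 1 + Msum`. [folklore] -/
theorem mixB_le_Msum {b c : ℝ} {e : ℝ × ℝ} (h : e ∈ pats b c) : mixB d e ≤ 1 + Msum d b c :=
  (le_sum_map_of_mem h (mixB d)).trans le_add_self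

/-- `‖B̃₁‖_mix ≤ mixB`. [folklore] -/
theorem pkNormMix_kB1w_le_mixB {e : ℝ × ℝ} (he : 0 ≤ e.2) : pkNormMix (kB1w d e.1 e.2) ≤ mixB d e :=
  pkNormMix_kB1w_le e.1 he

/-- `W̄ ≤ 1 + Wsum`. [folklore] -/
theorem haraWBar_le_Wsum {b c : ℝ} {e : ℝ × ℝ} (h : e ∈ pats b c) : haraWBar d e.1 e.2 ≤ 1 + Wsum d b c :=
  (le_sum_map_of_mem h fun e => haraWBar d e.1 e.2).trans le_add_self

/-- `|0|^{e₂} T̄^{(0,e₁)} ≤ 1 + Tsum`. [folklore] -/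
theorem wE_haraTBar_le_Tsum {b c : ℝ} {e : ℝ × ℝ} (h : e ∈ pats b c) :
    wE e.2 (0 : Site d) * haraTBar d 0 e.1 ≤ 1 + Tsum d b c :=
  (le_sum_map_of_mem h fun e => wE e.2 (0 : Site d) * haraTBar d 0 e.1).trans le_add_self

/-- A unit `B̃₁^{(e₁)} B̃₂^{(e₂)}` in `‖·‖_{∞→∞}`: `≤ b2B(e₂) rungB(e₁)`, and `≤ K` when free. [cite: Hara2008, §3.4 (Step 2)] -/
theorem pkNormInf_unit_le {c : ℝ} {e₁ e₂ : ℝ × ℝ} (h₁ : e₁ ∈ patsC c) (h₂ : e₂ ∈ patsC c) (he : 0 ≤ e₁.2) :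
    pkNormInf (pkMul (kB1w d e₁.1 e₁.2) (kB2W d e₂.1 e₂.2)) ≤ Usum d c := by
  refine ((pkNormInf_kProp_kB2W_le _ _ e₂.1 e₂.2).trans (mul_le_mul' le_rfl (pkNormInf_kRungR_kB1w_le_rungB he))).trans ?_
  refine le_trans ?_ le_add_self
  refine le_trans ?_ (le_sum_map_of_mem h₁ fun e₁ => ((patsC c).map fun e₂ => b2B d e₂ * rungB d e₁).sum)
  exact le_sum_map_of_mem h₂ fun e₂ => b2B d e₂ * rungB d e₁

/-- A free unit in `‖·‖_{∞→∞}` is `≤ K`. [cite: HeydenreichVanDerHofstad2017, (7.5.12)] -/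
theorem pkNormInf_unit_zero_le : pkNormInf (pkMul (kB1w d 0 0) (kB2W d 0 0)) ≤ KB d := by
  rw [kB1w_zero_zero, kB2W_zero_zero, KB]
  exact pkNormInf_kB1_kB2_le'.trans (le_of_eq (by ring))

/-- A reversed unit `B̃₂^{(e₂)} B̃₁^{(e₁)}` in `‖·‖_{1→1}`. [cite: Hara2008, §3.4 (Step 2)] -/
theorem pkNormOne_unit_le {c : ℝ} {e₁ e₂ : ℝ × ℝ} (h₁ : e₁ ∈ patsC c) (h₂ : e₂ ∈ patsC c) (he : 0 ≤ e₁.2) :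
    pkNormOne (pkMul (kB2W d e₂.1 e₂.2) (kB1w d e₁.1 e₁.2)) ≤ Usum d c := by
  refine ((pkNormOne_kB2W_kProp_le _ _ e₂.1 e₂.2).trans (mul_le_mul' le_rfl (pkNormOne_kRungL_kB1w_le_rungB he))).trans ?_
  refine le_trans ?_ le_add_self
  refine le_trans ?_ (le_sum_map_of_mem h₁ fun e₁ => ((patsC c).map fun e₂ => b2B d e₂ * rungB d e₁).sum)
  exact le_sum_map_of_mem h₂ fun e₂ => b2B d e₂ * rungB d e₁

/-- A free reversed unit in `‖·‖_{1→1}` is `≤ K`. [cite: HeydenreichVanDerHofstad2017, Exercise 7.5] -/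
theorem pkNormOne_unit_zero_le : pkNormOne (pkMul (kB2W d 0 0) (kB1w d 0 0)) ≤ KB d := by
  rw [kB1w_zero_zero, kB2W_zero_zero, KB]
  exact pkNormOne_kB2_kB1_le

/-- `K ≤ Usum`. [folklore] -/
theorem KB_le_Usum (c : ℝ) : KB d ≤ Usum d c := le_self_add

end Patterns

/-! ### Products over free units decay like `K^{#units}`; the marked chain is `≤ C K^{N-5}` -/

section PerChain

variable {d : ℕ}

/-- Unmarked positions carry zero exponents. [folklore] -/
theorem exv_of_ne {j l : ℕ} (b c : ℝ) {k : ℕ} (hj : k ≠ j) (hl : k ≠ l) : exv j l b c k = (0, 0) := by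
  unfold exv; rw [if_neg hj, if_neg hl]

/-- `‖P_{G^{(b)},G^{(c)}}‖_mix ≤ W̄^{(b,c)}`. [cite: Hara2008, §3.4 (Step 2, case (b-2))] -/
theorem pkNormMix_kProp_gE_le (b c : ℝ) : pkNormMix (kProp (gE d b) (gE d c)) ≤ haraWBar d b c := by
  rw [haraWBar_eq_wForm]; exact pkNormMix_kProp_le _ _ (gE_neg c)

/-- **Free units on the left**: all units zero gives `lnorm ≤ K^k`. [cite: HeydenreichVanDerHofstad2017, (7.5.9)] -/
theorem lnorm_le_pow_of_zero (ex : ℕ → ℝ × ℝ) (k : ℕ) : ∀ i₀ : ℕ,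
    (∀ idx, 2 * i₀ < idx → idx ≤ 2 * (i₀ + k) → ex idx = (0, 0)) → lnorm d ex i₀ k ≤ KB d ^ k := by
  induction k with
  | zero => intro i₀ _; simp [lnorm]
  | succ k ih =>
    intro i₀ h
    rw [lnorm, pow_succ']
    refine mul_le_mul' ?_ (ih (i₀ + 1) fun idx h1 h2 => h idx (by omega) (by omega))
    rw [h _ (by omega) (by omega), h (2 * (i₀ + 1)) (by omega) (by omega)]
    exact pkNormInf_unit_zero_le

/-- **Units on the left of the `b`-mark** (at most the unit of the `c`-mark is not free):
`lnorm ≤ (1 + Usum) K^{k-1}` (`K ≤ 1`). [cite: Hara2008, §3.4 (Step 3: "at least (N-2) open triangles")] -/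
theorem lnorm_exv_le {j l : ℕ} {b c : ℝ} (hb : 0 ≤ b) (hc : 0 ≤ c) (hKB : KB d ≤ 1) (k : ℕ) : ∀ i₀ : ℕ,
    2 * (i₀ + k) < j → lnorm d (exv j l b c) i₀ k ≤ (1 + Usum d c) * KB d ^ (k - 1) := by
  induction k with
  | zero => intro i₀ _; rw [lnorm, Nat.zero_sub, pow_zero, mul_one]; exact le_self_add
  | succ k ih =>
    intro i₀ hj
    rw [lnorm]
    by_cases hl : l = 2 * (i₀ + 1) - 1 ∨ l = 2 * (i₀ + 1)
    · -- the unit of the `c`-mark: the remaining units are free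
      have hrest : lnorm d (exv j l b c) (i₀ + 1) k ≤ KB d ^ k :=
        lnorm_le_pow_of_zero _ k (i₀ + 1) fun idx h1 h2 =>
          exv_of_ne (j := j) (l := l) b c (k := idx) (by omega) (by omega)
      have h₁ := exv_mem_patsC (j := j) (l := l) b c (k := 2 * (i₀ + 1) - 1) (by omega)
      have h₂ := exv_mem_patsC (j := j) (l := l) b c (k := 2 * (i₀ + 1)) (by omega)
      calc _ ≤ Usum d c * KB d ^ k := mul_le_mul' (pkNormInf_unit_le h₁ h₂
            (nonneg_of_mem_pats hb hc (patsC_subset_pats b c h₁)).2) hrest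
        _ ≤ (1 + Usum d c) * KB d ^ (k + 1 - 1) := by
            rw [Nat.add_sub_cancel]; exact mul_le_mul' le_add_self le_rfl
    · -- a free unit
      rw [not_or] at hl
      rw [exv_of_ne (j := j) (l := l) b c (k := 2 * (i₀ + 1) - 1) (by omega) (fun h => hl.1 h.symm),
        exv_of_ne (j := j) (l := l) b c (k := 2 * (i₀ + 1)) (by omega) (fun h => hl.2 h.symm)]
      calc _ ≤ KB d * ((1 + Usum d c) * KB d ^ (k - 1)) := mul_le_mul' pkNormInf_unit_zero_le (ih (i₀ + 1) (by omega))
        _ = (1 + Usum d c) * (KB d ^ (k - 1) * KB d) := by ring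
        _ ≤ (1 + Usum d c) * KB d ^ (k + 1 - 1) := by
            refine mul_le_mul' le_rfl ?_
            rw [← pow_succ, Nat.add_sub_cancel]
            exact pow_le_pow_right_of_le_one' hKB (by omega)

/-- **Free reversed units**: `rnormK ≤ K^k (1 + Ssum)` when all exponents in range vanish except the end's
pattern being away from the `b`-mark. [cite: HeydenreichVanDerHofstad2017, Exercise 7.5] -/
theorem rnormK_le_pow_of_zero {j l : ℕ} {b c : ℝ} (k : ℕ) : ∀ u : ℕ, j < 2 * u →
    (∀ idx, 2 * u ≤ idx → idx < 2 * (u + k) → exv j l b c idx = (0, 0)) →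
    rnormK d (exv j l b c) u k ≤ KB d ^ k * (1 + Ssum d c) := by
  induction k with
  | zero =>
    intro u hj _
    rw [rnormK, pow_zero, one_mul]
    exact pkNormOne_kEndW_le_Ssum (exv_mem_patsC b c (by omega))
  | succ k ih =>
    intro u hj h
    rw [rnormK, pow_succ', mul_assoc]
    refine mul_le_mul' ?_ (ih (u + 1) (by omega) fun idx h1 h2 => h idx (by omega) (by omega))
    rw [h _ le_rfl (by omega), h (2 * u + 1) (by omega) (by omega)]
    exact pkNormOne_unit_zero_le

/-- **Units on the right of the `b`-mark**: `rnormK ≤ (1 + Usum) K^{k-1} (1 + Ssum)` (`K ≤ 1`).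
[cite: Hara2008, §3.4 (Step 3)] -/
theorem rnormK_exv_le {j l : ℕ} {b c : ℝ} (hb : 0 ≤ b) (hc : 0 ≤ c) (hKB : KB d ≤ 1) (k : ℕ) : ∀ u : ℕ,
    j < 2 * u → rnormK d (exv j l b c) u k ≤ (1 + Usum d c) * KB d ^ (k - 1) * (1 + Ssum d c) := by
  induction k with
  | zero =>
    intro u hj
    rw [rnormK, pow_zero, mul_one]
    exact (pkNormOne_kEndW_le_Ssum (exv_mem_patsC b c (by omega))).trans (le_mul_of_one_le_left' le_self_add)
  | succ k ih =>
    intro u hj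
    rw [rnormK]
    by_cases hl : l = 2 * u ∨ l = 2 * u + 1
    · have hrest : rnormK d (exv j l b c) (u + 1) k ≤ KB d ^ k * (1 + Ssum d c) :=
        rnormK_le_pow_of_zero k (u + 1) (by omega) fun idx h1 h2 =>
          exv_of_ne (j := j) (l := l) b c (k := idx) (by omega) (by omega)
      have h₂ := exv_mem_patsC (j := j) (l := l) b c (k := 2 * u) (by omega)
      have h₁ := exv_mem_patsC (j := j) (l := l) b c (k := 2 * u + 1) (by omega)
      calc _ ≤ Usum d c * (KB d ^ k * (1 + Ssum d c)) := mul_le_mul' (pkNormOne_unit_le h₁ h₂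
            (nonneg_of_mem_pats hb hc (patsC_subset_pats b c h₁)).2) hrest
        _ ≤ (1 + Usum d c) * KB d ^ (k + 1 - 1) * (1 + Ssum d c) := by
            rw [Nat.add_sub_cancel, ← mul_assoc]; exact mul_le_mul' (mul_le_mul' le_add_self le_rfl) le_rfl
    · rw [not_or] at hl
      rw [exv_of_ne (j := j) (l := l) b c (k := 2 * u) (by omega) (fun h => hl.1 h.symm),
        exv_of_ne (j := j) (l := l) b c (k := 2 * u + 1) (by omega) (fun h => hl.2 h.symm)]
      calc _ ≤ KB d * ((1 + Usum d c) * KB d ^ (k - 1) * (1 + Ssum d c)) :=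
            mul_le_mul' pkNormOne_unit_zero_le (ih (u + 1) (by omega))
        _ = (1 + Usum d c) * (KB d ^ (k - 1) * KB d) * (1 + Ssum d c) := by ring
        _ ≤ (1 + Usum d c) * KB d ^ (k + 1 - 1) * (1 + Ssum d c) := by
            refine mul_le_mul' (mul_le_mul' le_rfl ?_) le_rfl
            rw [← pow_succ, Nat.add_sub_cancel]
            exact pow_le_pow_right_of_le_one' hKB (by omega)

/-- Merging the two geometric factors: `K^a K^{a'} ≤ K^{n-4}` when `a + a' ≥ n - 4` and `K ≤ 1`. [folklore] -/
theorem KB_pow_mul_pow_le (hKB : KB d ≤ 1) {a a' n : ℕ} (h : n - 4 ≤ a + a') :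
    KB d ^ a * KB d ^ a' ≤ KB d ^ (n - 4) := by
  rw [← pow_add]; exact pow_le_pow_right_of_le_one' hKB h

/-- **Every doubly marked chain of the diagram of `Π^{(N)}` is at most `C(b,c) K^{N-5}`** (`N = n+1`; marks at
`j, l < 2N+1`; `K = 2Δ̃_{p_c}Δ_{p_c} ≤ 1`): Hara's Step 2 on the chains, split at the `b`-mark.
[cite: Hara2008, §3.4 (Steps 2–3)] [cite: HeydenreichVanDerHofstad2017, §7.5.2] -/
theorem chain_exv_le {b c : ℝ} (hb : 0 ≤ b) (hc : 0 ≤ c) (hKB : KB d ≤ 1) (n : ℕ) {j l : ℕ}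
    (hj : j < 2 * n + 3) (hl : l < 2 * n + 3) :
    ∑' p, pkChainL (vDelta d) (mKsE d n (exv j l b c)) p * eDiag d p ≤ Cbig d b c * KB d ^ (n - 4) := by
  have hl' := hl
  set ex := exv j l b c with hex
  have hpat : ∀ k, ex k ∈ pats b c := fun k => exv_mem_pats j l b c k
  have hpatC : ∀ k, k ≠ j → ex k ∈ patsC c := fun k hk => exv_mem_patsC b c hk
  have hnn : ∀ k, 0 ≤ (ex k).1 ∧ 0 ≤ (ex k).2 := fun k => nonneg_of_mem_pats hb hc (hpat k)
  -- abbreviations of the sums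
  set S := 1 + Ssum d c with hS
  set U := 1 + Usum d c with hU
  set M := 1 + Msum d b c with hM
  set R := 1 + Rsum d c with hR
  set W := 1 + Wsum d b c with hW
  set T := 1 + Tsum d b c with hT
  have h1S : 1 ≤ S := le_self_add
  have h1U : 1 ≤ U := le_self_add
  have h1M : 1 ≤ M := le_self_add
  have h1R : 1 ≤ R := le_self_add
  have h1W : 1 ≤ W := le_self_add
  have h1T : 1 ≤ T := le_self_add
  have hCbig : Cbig d b c = S ^ 2 * U ^ 2 * (M * R + W * R ^ 2 + M * T * R) := rfl
  -- the four positions of the `b`-mark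
  rcases Nat.eq_zero_or_pos j with hj0 | hjpos
  · -- `j = 0`: split at the start
    subst hj0
    refine (chain_le_split_start n ex).trans ?_
    have e1 : pkNormMix (kProp (gE d (ex 0).1) (gE d (ex 0).2)) ≤ W :=
      (pkNormMix_kProp_gE_le _ _).trans (haraWBar_le_Wsum (hpat 0))
    have e2 : pkNormOne (kRungL (kB1w d (ex 1).1 (ex 1).2)) ≤ R :=
      (pkNormOne_kRungL_kB1w_le_rungB (hnn 1).2).trans (rungB_le_Rsum (hpatC 1 (by omega)))
    have e3 : rnormK d ex 1 n ≤ U * KB d ^ (n - 1) * S := rnormK_exv_le hb hc hKB n 1 (by omega)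
    calc _ ≤ W * (R * (U * KB d ^ (n - 1) * S)) := mul_le_mul' e1 (mul_le_mul' e2 e3)
      _ = S * U * (W * R) * KB d ^ (n - 1) := by ring
      _ ≤ S ^ 2 * U ^ 2 * (M * R + W * R ^ 2 + M * T * R) * KB d ^ (n - 4) := by
          refine mul_le_mul' ?_ (pow_le_pow_right_of_le_one' hKB (by omega))
          refine mul_le_mul' (mul_le_mul' ?_ ?_) ?_
          · rw [pow_two]; exact le_mul_of_one_le_right' h1S
          · rw [pow_two]; exact le_mul_of_one_le_right' h1U
          · calc W * R ≤ W * R ^ 2 := mul_le_mul' le_rfl (by rw [pow_two]; exact le_mul_of_one_le_right' h1R)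
              _ ≤ M * R + W * R ^ 2 := le_add_self
              _ ≤ _ := le_self_add
  by_cases hjend : j = 2 * n + 2
  · -- `j = 2n+2`: split at the end
    subst hjend
    refine (chain_le_split_end n ex).trans ?_
    have e0 : pkNormInf (kStartW d (ex 0).1 (ex 0).2) ≤ S := pkNormInf_kStartW_le_Ssum (hpatC 0 (by omega))
    have e1 : lnorm d ex 0 n ≤ U * KB d ^ (n - 1) := lnorm_exv_le hb hc hKB n 0 (by omega)
    have e2 : pkNormInf (kRungR (kB1w d (ex (2 * n + 1)).1 (ex (2 * n + 1)).2)) ≤ R :=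
      (pkNormInf_kRungR_kB1w_le_rungB (hnn _).2).trans (rungB_le_Rsum (hpatC _ (by omega)))
    have e3 : pkNormMix (kProp (gE d (ex (2 * n + 2)).1) (gE d (ex (2 * n + 2)).2)) ≤ W :=
      (pkNormMix_kProp_gE_le _ _).trans (haraWBar_le_Wsum (hpat _))
    calc _ ≤ S * (U * KB d ^ (n - 1)) * (R * W) := mul_le_mul' (mul_le_mul' e0 e1) (mul_le_mul' e2 e3)
      _ = S * U * (W * R) * KB d ^ (n - 1) := by ring
      _ ≤ S ^ 2 * U ^ 2 * (M * R + W * R ^ 2 + M * T * R) * KB d ^ (n - 4) := by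
          refine mul_le_mul' ?_ (pow_le_pow_right_of_le_one' hKB (by omega))
          refine mul_le_mul' (mul_le_mul' ?_ ?_) ?_
          · rw [pow_two]; exact le_mul_of_one_le_right' h1S
          · rw [pow_two]; exact le_mul_of_one_le_right' h1U
          · calc W * R ≤ W * R ^ 2 := mul_le_mul' le_rfl (by rw [pow_two]; exact le_mul_of_one_le_right' h1R)
              _ ≤ M * R + W * R ^ 2 := le_add_self
              _ ≤ _ := le_self_add
  rcases Nat.even_or_odd j with ⟨u, hu⟩ | ⟨u', hu'⟩
  · -- `j = 2u`, `1 ≤ u ≤ n`: split at the `B₂` of unit `u`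
    have hu1 : 1 ≤ u := by omega
    have hun : u ≤ n := by omega
    have hj2 : j = 2 * u := by omega
    refine (chain_le_split_B2 n ex hu1 hun).trans ?_
    have e0 : pkNormInf (kStartW d (ex 0).1 (ex 0).2) ≤ S := pkNormInf_kStartW_le_Ssum (hpatC 0 (by omega))
    have e1 : lnorm d ex 0 (u - 1) ≤ U * KB d ^ (u - 1 - 1) := lnorm_exv_le hb hc hKB (u - 1) 0 (by omega)
    have e2 : pkNormInf (kRungR (kB1w d (ex (2 * u - 1)).1 (ex (2 * u - 1)).2)) ≤ R :=
      (pkNormInf_kRungR_kB1w_le_rungB (hnn _).2).trans (rungB_le_Rsum (hpatC _ (by omega)))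
    have e3 : haraWBar d (ex (2 * u)).1 (ex (2 * u)).2 ≤ W := haraWBar_le_Wsum (hpat _)
    have e4 : pkNormOne (kRungL (kB1w d (ex (2 * u + 1)).1 (ex (2 * u + 1)).2)) ≤ R :=
      (pkNormOne_kRungL_kB1w_le_rungB (hnn _).2).trans (rungB_le_Rsum (hpatC _ (by omega)))
    have e5 : pkNormMix (kB1w d (ex (2 * u - 1)).1 (ex (2 * u - 1)).2) ≤ M :=
      (pkNormMix_kB1w_le_mixB (hnn _).2).trans (mixB_le_Msum (hpat _))
    have e6 : wE (ex (2 * u)).2 (0 : Site d) * haraTBar d 0 (ex (2 * u)).1 ≤ T := wE_haraTBar_le_Tsum (hpat _)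
    have e7 : rnormK d ex (u + 1) (n - u) ≤ U * KB d ^ (n - u - 1) * S := rnormK_exv_le hb hc hKB (n - u) (u + 1) (by omega)
    calc _ ≤ S * (U * KB d ^ (u - 1 - 1)) * (R * W * R + M * (T * R)) * (U * KB d ^ (n - u - 1) * S) :=
          mul_le_mul' (mul_le_mul' (mul_le_mul' e0 e1) (add_le_add (mul_le_mul' (mul_le_mul' e2 e3) e4)
            (mul_le_mul' e5 (mul_le_mul' e6 e4)))) e7
      _ = S ^ 2 * U ^ 2 * (W * R ^ 2 + M * T * R) * (KB d ^ (u - 1 - 1) * KB d ^ (n - u - 1)) := by ring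
      _ ≤ S ^ 2 * U ^ 2 * (M * R + W * R ^ 2 + M * T * R) * KB d ^ (n - 4) := by
          refine mul_le_mul' (mul_le_mul' le_rfl ?_) (KB_pow_mul_pow_le hKB (by omega))
          rw [add_assoc]; exact le_add_self
  · -- `j = 2u'+1 = 2u-1`, `1 ≤ u ≤ n+1`: split at the `B₁` of unit `u`
    set u := u' + 1 with hu
    have hj2 : j = 2 * u - 1 := by omega
    have hu1 : 1 ≤ u := by omega
    have hun : u ≤ n + 1 := by omega
    refine (chain_le_split_B1 n ex hu1 hun).trans ?_
    have e0 : pkNormInf (kStartW d (ex 0).1 (ex 0).2) ≤ S := pkNormInf_kStartW_le_Ssum (hpatC 0 (by omega))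
    have e1 : lnorm d ex 0 (u - 1) ≤ U * KB d ^ (u - 1 - 1) := lnorm_exv_le hb hc hKB (u - 1) 0 (by omega)
    have e2 : pkNormMix (kB1w d (ex (2 * u - 1)).1 (ex (2 * u - 1)).2) ≤ M :=
      (pkNormMix_kB1w_le_mixB (hnn _).2).trans (mixB_le_Msum (hpat _))
    have e3 : rnormK d ex u (n + 1 - u) ≤ U * KB d ^ (n + 1 - u - 1) * S := rnormK_exv_le hb hc hKB (n + 1 - u) u (by omega)
    calc _ ≤ S * (U * KB d ^ (u - 1 - 1)) * M * (U * KB d ^ (n + 1 - u - 1) * S) :=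
          mul_le_mul' (mul_le_mul' (mul_le_mul' e0 e1) e2) e3
      _ = S ^ 2 * U ^ 2 * M * (KB d ^ (u - 1 - 1) * KB d ^ (n + 1 - u - 1)) := by ring
      _ ≤ S ^ 2 * U ^ 2 * (M * R + W * R ^ 2 + M * T * R) * KB d ^ (n - 4) := by
          refine mul_le_mul' (mul_le_mul' le_rfl ?_) (KB_pow_mul_pow_le hKB (by omega))
          exact (le_mul_of_one_le_right' h1R).trans (le_self_add.trans le_self_add)

end PerChain

end Literature.Barriers.CriticalPhenomena
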